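import Summits.Parity.GeneralizedHardyLittlewood.Theorems.ElliottHalberstam.Negative.ElliottHalberstamLoadBearing
import Literature.NumberTheory.Sieve.ParityBarrierLevelProofs

/-!
# `ElliottHalberstam` (stmt-Parity-14092): what the crux really quantifies over

Structure lemmas for the crux `Literature.NumberTheory.Sieve.LevelOfDistribution.ElliottHalberstam` (the
Elliott–Halberstam conjecture, by name; cdisprove work file `Cruxes/ElliottHalberstam/Disproof.lean` §5):

* `elliottHalberstam_iff_primesHaveLevel_one` — the `θ < 1` family IS the endpoint statement
  `PrimesHaveLevel 1` (the `ε`-slack absorbs `1 − θ`);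
* `elliottHalberstam_iff_sharp` — EH ⇔ sharp level `x^θ` (no `ε`) for every `θ < 1`, while sharp level
  at `θ = 1` is false (`not_primesHaveSharpLevel_one`): the crux is exactly everything short of the
  trivially false endpoint;
* `elliottHalberstam_iff_Ico_half` — only `θ ∈ [1/2, 1)` has content (`θ < 1/2` is the tree's PROVED
  `BombieriVinogradovStatement_holds`);
* (`θ ≤ 0` is vacuous: Literature `PrimesHaveLevel.of_nonpos`, LevelOfDistributionProofs.lean — used, not restated.)
None of these asserts the crux. [folklore]
-/

namespace Summit.Parity.GeneralizedHardyLittlewood.Theorems.ElliottHalberstam.Negative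

open Filter Asymptotics Finset Real
open Literature.NumberTheory.Sieve Literature.NumberTheory.Sieve.LevelOfDistribution

/-! ## §5 Structure: what the crux really quantifies over -/

/-- **The `θ < 1` family is the endpoint statement.** `ElliottHalberstam ↔ PrimesHaveLevel 1`
(the `ε`-slack of `PrimesHaveLevel` absorbs the gap `1 − θ`). -/
theorem elliottHalberstam_iff_primesHaveLevel_one :
    Literature.NumberTheory.Sieve.LevelOfDistribution.ElliottHalberstam ↔ PrimesHaveLevel 1 := by
  constructor
  · intro h A hA ε hε
    have h' := h (1 - ε / 2) (by linarith) A hA (ε / 2) (by linarith)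
    have e : 1 - ε / 2 - ε / 2 = 1 - ε := by ring
    rw [e] at h'
    exact h'
  · intro h θ hθ
    exact h.mono hθ.le

/-- **EH ⇔ sharp level `x^θ` for every `θ < 1`** — while sharp level at `θ = 1` is false
(`not_primesHaveSharpLevel_one`): the crux is exactly "everything short of the trivially false
endpoint", so no cheap misstatement-kill exists on the level side. -/
theorem elliottHalberstam_iff_sharp :
    Literature.NumberTheory.Sieve.LevelOfDistribution.ElliottHalberstam ↔
      ∀ θ : ℝ, θ < 1 → PrimesHaveSharpLevel θ := by
  constructor
  · intro h θ hθ
    exact primesHaveSharpLevel_of_lt (h ((θ + 1) / 2) (by linarith)) (by linarith)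
  · intro h θ hθ A hA ε hε
    exact h (θ - ε) (by linarith) A hA

/-- **Only `θ ∈ [1/2, 1)` has content**: below `1/2` the crux is the Bombieri–Vinogradov theorem,
PROVED in the tree (`BombieriVinogradovStatement_holds`, axioms `propext/Classical.choice/Quot.sound`). -/
theorem elliottHalberstam_iff_Ico_half :
    Literature.NumberTheory.Sieve.LevelOfDistribution.ElliottHalberstam ↔
      ∀ θ : ℝ, 1 / 2 ≤ θ → θ < 1 → PrimesHaveLevel θ := by
  constructor
  · intro h θ _ hθ; exact h θ hθ
  · intro h θ hθ
    rcases lt_or_ge θ (1 / 2) with hlt | hge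
    · exact BombieriVinogradovStatement_holds θ hlt
    · exact h θ hge hθ

/-! `θ ≤ 0` is vacuous (empty modulus range): this is the Literature theorem
`Literature.NumberTheory.Sieve.PrimesHaveLevel.of_nonpos` (LevelOfDistributionProofs.lean) — not
restated here. -/

end Summit.Parity.GeneralizedHardyLittlewood.Theorems.ElliottHalberstam.Negative
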